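import Summits.AnomalousDissipation.AnomalousDissipation.Theorems.SolenoidalFractalHomogenisationRealisedQuasiStaticCellLawUpperSomeScalars
import HarnessLib

/-!
# K2R `RealisedQuasiStaticCellLaw`, line `floquet-bloch`, stub `stub_upperSome`: the rate budget of the cell constants
# (helper; `--supports stmt-AnomalousDissipation-20446`)

Summits-side helper file (everything proved; no definitions, no named facts; real arithmetic only). The per-slot and
summed pieces of the rate budget of `upperSome_galerkin_lower` at the replayed cell word: with `X = 42MG²/π²`
(`G = ‖ℓ‖/(nν)`), the slack terms, the cone term `26βη`, and the drift terms fit into `(δ-ε)X/3` under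
`10⁴MG ≤ δ ≤ 1`, `M ≥ 1000/δ²`, `‖ℓ‖/n ≤ δ/(10⁹M)`, `ε = δ/8` (`cell_budget`).
This is NOT a proof of Onsager's conjecture nor of anomalous dissipation.
-/

set_option linter.dupNamespace false

noncomputable section

namespace Summit.AnomalousDissipation.AnomalousDissipation.Theorems.SolenoidalFractalHomogenisation.RealisedQuasiStaticCellLaw

open Real

/-- **Budget: the cone term** `26βη ≤ 3δMG²/π²` (`M ≥ 1000/δ²`). -/
theorem cell_budget_eta {G δ ε M Δ β η : ℝ} (hΔ : Δ = 7 / 16) (hβ : β = 2 / (Δ * ε)) (hε : ε = δ / 8)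
    (hη : η = 8 * G ^ 2 / π ^ 4) (hδ : 0 < δ) (hMδ : 1000 ≤ δ ^ 2 * M) :
    26 * (β * η) ≤ 3 * δ * M * G ^ 2 / π ^ 2 := by
  have hπ := pi_sq_bounds
  have hδ0 : δ ≠ 0 := hδ.ne'
  have hπ0 : π ≠ 0 := Real.pi_pos.ne'
  have hβv : β = 256 / (7 * δ) := by rw [hβ, hΔ, hε]; field_simp; norm_num
  rw [hβv, hη, show 26 * (256 / (7 * δ) * (8 * G ^ 2 / π ^ 4)) = 53248 / 7 * G ^ 2 / (δ * π ^ 4) by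
    field_simp; ring, div_le_div_iff₀ (by positivity) (by positivity)]
  have h1 : 0 ≤ G ^ 2 * π ^ 2 * (3 * δ ^ 2 * M * π ^ 2 - 53248 / 7) := by
    refine mul_nonneg (by positivity) ?_
    have := mul_le_mul hMδ hπ.1.le (by norm_num) (by positivity)
    linarith
  linarith [h1, show G ^ 2 * π ^ 2 * (3 * δ ^ 2 * M * π ^ 2 - 53248 / 7) =
    3 * δ * M * G ^ 2 * (δ * π ^ 4) - 53248 / 7 * G ^ 2 * π ^ 2 by ring]

set_option maxHeartbeats 400000 in
/-- **Budget: one slack term** `40βcTg⁴(1+g²σ²)/Δ³ + 48βcg²/(ρτ″ΛΔ³) ≤ (3/26)δMG²/π²`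
(`c ∈ [0,2]`, `σ ∈ [0,28]`). -/
theorem cell_slack_le {g G δ ε M σ c Δ β Λ τ'' ρ T : ℝ} (hg : |g| ≤ G / (8 * π ^ 2))
    (hGs : 10 ^ 4 * M * G ≤ δ) (hδ : 0 < δ) (hδ1 : δ ≤ 1) (hM : 1000 ≤ M) (hMδ : 1000 ≤ δ ^ 2 * M)
    (hε : ε = δ / 8) (hσ0 : 0 ≤ σ) (hσ : σ ≤ 28) (hc0 : 0 ≤ c) (hc : c ≤ 2) (hΔ : Δ = 7 / 16)
    (hβ : β = 2 / (Δ * ε)) (hρ : ρ = 1 / 2) (hΛ : 0 < Λ) (hτ : 0 < τ'') (hT : Λ * τ'' = T)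
    (hTM : 1579 * M ≤ T) (hTg : T * g ^ 2 ≤ 5 * M * G ^ 2 / (2 * π ^ 2)) :
    40 * β * c * Λ * τ'' * g ^ 4 * (1 + g ^ 2 * σ ^ 2) / Δ ^ 3 + 48 * β * c * g ^ 2 / (ρ * τ'' * Λ * Δ ^ 3) ≤
      3 / 26 * (δ * M * G ^ 2 / π ^ 2) := by
  have hπ := pi_sq_bounds
  obtain ⟨hG0, hGu, hg78, hMG2, hg2, hGδ⟩ := cell_small_facts hg hGs hδ1 hM
  have hM0 : 0 < M := by linarith
  have hT0 : 0 < T := by rw [← hT]; positivity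
  have hδ0 : δ ≠ 0 := hδ.ne'
  have hΛ0 : Λ ≠ 0 := hΛ.ne'
  have hτ0 : τ'' ≠ 0 := hτ.ne'
  have hΔ0 : Δ ≠ 0 := by rw [hΔ]; norm_num
  have hρ0 : ρ ≠ 0 := by rw [hρ]; norm_num
  have hβv : β = 256 / (7 * δ) := by rw [hβ, hΔ, hε]; field_simp; norm_num
  have hTg0 : 0 ≤ T * g ^ 2 := by positivity
  have hX0 : 0 ≤ δ * M * G ^ 2 / π ^ 2 := by positivity
  have e : 40 * β * c * Λ * τ'' * g ^ 4 * (1 + g ^ 2 * σ ^ 2) / Δ ^ 3 + 48 * β * c * g ^ 2 / (ρ * τ'' * Λ * Δ ^ 3) =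
      40 * c / Δ ^ 3 * β * (T * g ^ 2) * (g ^ 2 * (1 + g ^ 2 * σ ^ 2)) + 48 * c / (ρ * Δ ^ 3) * β * g ^ 2 / T := by
    rw [← hT]
    field_simp
    try ring
  rw [e]
  clear e
  have hg2u : g ^ 2 ≤ 1 / 10 ^ 17 := by
    refine hg2.trans ?_
    rw [div_le_div_iff₀ (by norm_num) (by norm_num)]
    nlinarith
  -- term A
  have hA : 40 * c / Δ ^ 3 * β * (T * g ^ 2) * (g ^ 2 * (1 + g ^ 2 * σ ^ 2)) ≤ 3 / 52 * (δ * M * G ^ 2 / π ^ 2) := by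
    have hP : 40 * c / Δ ^ 3 * β ≤ 35000 / δ := by
      have e3 : 40 * c / Δ ^ 3 * β = 41943040 / 2401 * c / δ := by rw [hβv, hΔ]; field_simp; ring
      rw [e3]
      exact div_le_div_of_nonneg_right (by linarith only [hc]) hδ.le
    have hP0 : 0 ≤ 40 * c / Δ ^ 3 * β := by rw [hΔ, hβv]; positivity
    have hσ2 : g ^ 2 * σ ^ 2 ≤ 1 / 10 ^ 17 * 28 ^ 2 :=
      mul_le_mul hg2u (pow_le_pow_left₀ hσ0 hσ 2) (sq_nonneg _) (by norm_num)
    -- `g²(1+g²σ²) ≤ 2g² ≤ 2G·(δ/10⁷)/6084`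
    have h2 : g ^ 2 * (1 + g ^ 2 * σ ^ 2) ≤ G ^ 2 / 6084 * 2 :=
      mul_le_mul hg2 (by linarith only [hσ2]) (by positivity) (by positivity)
    have h3 : 40 * c / Δ ^ 3 * β * (T * g ^ 2) * (g ^ 2 * (1 + g ^ 2 * σ ^ 2)) ≤
        35000 / δ * (5 * M * G ^ 2 / (2 * π ^ 2)) * (G ^ 2 / 6084 * 2) :=
      mul_le_mul (mul_le_mul hP hTg hTg0 (div_nonneg (by norm_num) hδ.le)) h2 (by positivity) (by positivity)
    refine h3.trans ?_
    rw [show 35000 / δ * (5 * M * G ^ 2 / (2 * π ^ 2)) * (G ^ 2 / 6084 * 2) =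
      (δ * M * G ^ 2 / π ^ 2) * (175000 / 6084 * (G ^ 2 / δ ^ 2)) by field_simp; ring]
    have h4 : G ^ 2 / δ ^ 2 ≤ 1 / 10 ^ 14 := by
      rw [div_le_div_iff₀ (by positivity) (by norm_num)]
      have := pow_le_pow_left₀ (by positivity) hGδ 2
      linarith [this, show ((10:ℝ) ^ 7 * G) ^ 2 = G ^ 2 * 10 ^ 14 by ring]
    have h5 : (δ * M * G ^ 2 / π ^ 2) * (175000 / 6084 * (G ^ 2 / δ ^ 2)) ≤
        (δ * M * G ^ 2 / π ^ 2) * (175000 / 6084 * (1 / 10 ^ 14)) :=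
      mul_le_mul_of_nonneg_left (mul_le_mul_of_nonneg_left h4 (by norm_num)) hX0
    refine h5.trans ?_
    nlinarith only [hX0]
  -- term B
  have hB : 48 * c / (ρ * Δ ^ 3) * β * g ^ 2 / T ≤ 3 / 52 * (δ * M * G ^ 2 / π ^ 2) := by
    have hP : 48 * c / (ρ * Δ ^ 3) * β ≤ 84000 / δ := by
      have e3 : 48 * c / (ρ * Δ ^ 3) * β = 100663296 / 2401 * c / δ := by rw [hβv, hΔ, hρ]; field_simp; ring
      rw [e3]
      exact div_le_div_of_nonneg_right (by linarith only [hc]) hδ.le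
    rw [div_le_iff₀ hT0]
    have h1 : 48 * c / (ρ * Δ ^ 3) * β * g ^ 2 ≤ 84000 / δ * (G ^ 2 / 6084) :=
      mul_le_mul hP hg2 (sq_nonneg _) (div_nonneg (by norm_num) hδ.le)
    refine h1.trans ?_
    have h2 : 3 / 52 * (δ * M * G ^ 2 / π ^ 2) * (1579 * M) ≤ 3 / 52 * (δ * M * G ^ 2 / π ^ 2) * T :=
      mul_le_mul_of_nonneg_left hTM (by positivity)
    refine le_trans ?_ h2
    rw [show 3 / 52 * (δ * M * G ^ 2 / π ^ 2) * (1579 * M) = G ^ 2 * (4737 / 52 * δ * M ^ 2 / π ^ 2) by ring,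
      show 84000 / δ * (G ^ 2 / 6084) = G ^ 2 * (84000 / 6084 / δ) by ring]
    refine mul_le_mul_of_nonneg_left ?_ (sq_nonneg _)
    rw [div_le_div_iff₀ hδ (by positivity)]
    -- `84000/6084·π² ≤ (4737/52)δ²M²`
    have hM2 : 1000 * 1000 ≤ δ ^ 2 * M * M := by nlinarith
    nlinarith
  linarith only [hA, hB]

/-- **Budget: one drift increment** `exp(x)·(Λ|g|(√2+γ))τ″ ≤ 5MτG` (`x ≤ 1`, `T|g| ≤ MτG/2`, `γ² ≤ 2`). -/
theorem cell_drift_le {x Λ g γ τ'' T M τ G : ℝ} (hx : x ≤ 1) (hΛ : 0 < Λ) (hτ'' : 0 < τ'') (hT : Λ * τ'' = T)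
    (hTg : T * |g| ≤ M * τ * G / 2) (hγ0 : 0 ≤ γ) (hγ : γ ^ 2 ≤ 2) :
    exp x * (Λ * |g| * (Real.sqrt 2 + γ)) * τ'' ≤ 5 * (M * τ * G) := by
  have he : exp x ≤ 3 := (Real.exp_le_exp.2 hx).trans Real.exp_one_lt_three.le
  have hs2 : Real.sqrt 2 ≤ 3 / 2 := by
    rw [Real.sqrt_le_left (by norm_num)]; norm_num
  have hγ1 : γ ≤ 3 / 2 := by nlinarith
  have hs0 : 0 ≤ Real.sqrt 2 + γ := by positivity
  have hT0 : 0 ≤ T * |g| := by rw [← hT]; positivity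
  have h0 : 0 ≤ M * τ * G := by linarith
  have e : exp x * (Λ * |g| * (Real.sqrt 2 + γ)) * τ'' = exp x * ((T * |g|) * (Real.sqrt 2 + γ)) := by
    rw [← hT]; ring
  rw [e]
  have h1 : (T * |g|) * (Real.sqrt 2 + γ) ≤ (M * τ * G / 2) * 3 :=
    mul_le_mul hTg (by linarith) hs0 (by positivity)
  have h2 : exp x * ((T * |g|) * (Real.sqrt 2 + γ)) ≤ 3 * ((M * τ * G / 2) * 3) :=
    mul_le_mul he h1 (mul_nonneg hT0 hs0) (by norm_num)
  linarith

/-- **Budget: the drift factor** `exp(y)·S·√(3η) ≤ δ/1000` (`y ≤ 1`, `0 ≤ S ≤ 18600MG`, `η = 8G²/π⁴`). -/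
theorem cell_kd_le {y S η G δ M g : ℝ} (hy : y ≤ 1) (hS0 : 0 ≤ S) (hS : S ≤ 18600 * (M * G))
    (hη : η = 8 * G ^ 2 / π ^ 4) (hg : |g| ≤ G / (8 * π ^ 2)) (hGs : 10 ^ 4 * M * G ≤ δ) (hδ1 : δ ≤ 1)
    (hM : 1000 ≤ M) :
    exp y * S * Real.sqrt (3 * η) ≤ δ / 1000 := by
  have hπ := pi_sq_bounds
  obtain ⟨hG0, hGu, -, hMG2, -, hGδ⟩ := cell_small_facts hg hGs hδ1 hM
  have he : exp y ≤ 3 := (Real.exp_le_exp.2 hy).trans Real.exp_one_lt_three.le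
  have hsq : Real.sqrt (3 * η) ≤ G / 2 := by
    rw [Real.sqrt_le_left (by positivity), hη]
    have hπ4 : 96 ≤ π ^ 4 := by nlinarith
    rw [show 3 * (8 * G ^ 2 / π ^ 4) = 24 * G ^ 2 / π ^ 4 by ring, div_le_iff₀ (by positivity)]
    nlinarith [mul_le_mul_of_nonneg_left hπ4 (sq_nonneg G)]
  have h1 : exp y * S ≤ 3 * (18600 * (M * G)) := mul_le_mul he hS hS0 (by norm_num)
  have h2 : exp y * S * Real.sqrt (3 * η) ≤ 3 * (18600 * (M * G)) * (G / 2) :=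
    mul_le_mul h1 hsq (Real.sqrt_nonneg _) (by positivity)
  refine h2.trans ?_
  rw [show 3 * (18600 * (M * G)) * (G / 2) = 27900 * (M * G ^ 2) by ring]
  have hδ0 : 0 ≤ δ := le_trans (by positivity) hGδ
  have h4 : δ * G ≤ δ * (1 / 10 ^ 7) := mul_le_mul_of_nonneg_left hGu hδ0
  linarith

/-- **Budget: assembly.** With `X = 42MG²/π²`: the slack, cone and drift remainders fit into `(δ-ε)X/3`. -/
theorem cell_budget {Ssl A26 βη26 κd rr δ ε M G X : ℝ} (hε : ε = δ / 8) (hδ : 0 < δ) (hδ1 : δ ≤ 1)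
    (hM : 1000 ≤ M) (hX : X = 42 * M * G ^ 2 / π ^ 2)
    (hSsl : Ssl ≤ 26 * (3 / 13 * (δ * M * G ^ 2 / π ^ 2))) (hβη : βη26 ≤ 3 * δ * M * G ^ 2 / π ^ 2)
    (hA0 : 0 ≤ A26) (hA : A26 ≤ 26 * (5 * M * G ^ 2 / π ^ 2)) (hκ0 : 0 ≤ κd) (hκd : κd ≤ δ / 1000)
    (hr0 : 0 ≤ rr) (hrr : rr ≤ δ / (10 ^ 9 * M)) :
    Ssl + βη26 + (1 + ε) * (1 - 4 * (1 / 2 : ℝ) / 3) * ((16 * κd + 26 * rr) * A26) ≤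
      (δ - ε) * (1 - 4 * (1 / 2 : ℝ) / 3) * X := by
  have hπ := pi_sq_bounds
  have hM0 : 0 < M := by linarith
  have hY0 : 0 ≤ M * G ^ 2 / π ^ 2 := by positivity
  have hrr' : rr ≤ δ / 10 ^ 9 := hrr.trans (by
    rw [div_le_div_iff₀ (by positivity) (by norm_num)]; nlinarith)
  have hk : 16 * κd + 26 * rr ≤ δ / 50 := by linarith
  have hk0 : 0 ≤ 16 * κd + 26 * rr := by positivity
  have h1 : (16 * κd + 26 * rr) * A26 ≤ δ / 50 * (26 * (5 * M * G ^ 2 / π ^ 2)) := mul_le_mul hk hA hA0 (by positivity)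
  have h2 : (1 + ε) * (1 - 4 * (1 / 2 : ℝ) / 3) * ((16 * κd + 26 * rr) * A26) ≤
      (9 / 8) * (1 / 3) * (δ / 50 * (26 * (5 * M * G ^ 2 / π ^ 2))) := by
    refine mul_le_mul ?_ h1 (by positivity) (by positivity)
    rw [hε]; nlinarith
  rw [hX, hε]
  have e1 : 26 * (3 / 13 * (δ * M * G ^ 2 / π ^ 2)) = 6 * δ * (M * G ^ 2 / π ^ 2) := by ring
  have e2 : 3 * δ * M * G ^ 2 / π ^ 2 = 3 * δ * (M * G ^ 2 / π ^ 2) := by ring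
  have e3 : (9 / 8) * (1 / 3) * (δ / 50 * (26 * (5 * M * G ^ 2 / π ^ 2))) = 39 / 40 * δ * (M * G ^ 2 / π ^ 2) := by ring
  have e4 : (δ - δ / 8) * (1 - 4 * (1 / 2 : ℝ) / 3) * (42 * M * G ^ 2 / π ^ 2) = 49 / 4 * δ * (M * G ^ 2 / π ^ 2) := by
    ring
  rw [e1] at hSsl
  rw [e2] at hβη
  rw [e3] at h2
  rw [e4]
  nlinarith [mul_nonneg hδ.le hY0]

/-- The heat exponents of the slow sector over one cell slot / period are at most one:
`(ν/n²)(4π²‖ℓ‖²)(Mτ/ν) ≤ 1` for `τ ≤ 3720`, `‖ℓ‖/n ≤ δ/(10⁹M)`, `δ ≤ 1`, `M ≥ 1000`. -/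
theorem cell_heat_le_one {A n ν M τ δ : ℝ} (hn : 0 < n) (hν : 0 < ν) (hM : 1000 ≤ M) (hδ1 : δ ≤ 1) (hA : 0 ≤ A)
    (hrr : A / n ≤ δ / (10 ^ 9 * M)) (hτ0 : 0 ≤ τ) (hτ : τ ≤ 3720) :
    ν / n ^ 2 * (4 * Real.pi ^ 2 * A ^ 2) * (M * τ / ν) ≤ 1 := by
  have hπ := pi_sq_bounds
  have hM0 : 0 < M := by linarith
  have e : ν / n ^ 2 * (4 * Real.pi ^ 2 * A ^ 2) * (M * τ / ν) = 4 * Real.pi ^ 2 * τ * (M * (A / n) ^ 2) := by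
    field_simp
  rw [e]
  have hr : A / n ≤ 1 / (10 ^ 9 * M) := hrr.trans (div_le_div_of_nonneg_right hδ1 (by positivity))
  have hr0 : 0 ≤ A / n := by positivity
  have h1 : A / n * (10 ^ 9 * M) ≤ 1 := (le_div_iff₀ (by positivity)).1 hr
  have h2 : M * (A / n) ≤ 1 / 10 ^ 9 := by linarith
  have h3 : A / n ≤ 1 / 10 ^ 12 := by
    have : A / n * (10 ^ 9 * 1000) ≤ A / n * (10 ^ 9 * M) := mul_le_mul_of_nonneg_left (by linarith) hr0
    linarith
  have h4 : M * (A / n) ^ 2 ≤ 1 / 10 ^ 9 * (1 / 10 ^ 12) := by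
    rw [show M * (A / n) ^ 2 = (M * (A / n)) * (A / n) by ring]
    exact mul_le_mul h2 h3 hr0 (by norm_num)
  have h5 : τ * (M * (A / n) ^ 2) ≤ 3720 * (1 / 10 ^ 9 * (1 / 10 ^ 12)) := mul_le_mul hτ h4 (by positivity) (by norm_num)
  have h6 : 4 * Real.pi ^ 2 ≤ 40 := by linarith [hπ.2]
  calc 4 * Real.pi ^ 2 * τ * (M * (A / n) ^ 2) = (4 * Real.pi ^ 2) * (τ * (M * (A / n) ^ 2)) := by ring
    _ ≤ 40 * (3720 * (1 / 10 ^ 9 * (1 / 10 ^ 12))) := mul_le_mul h6 h5 (by positivity) (by norm_num)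
    _ ≤ 1 := by norm_num


end Summit.AnomalousDissipation.AnomalousDissipation.Theorems.SolenoidalFractalHomogenisation.RealisedQuasiStaticCellLaw

end
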